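import Summits.BirchSwinnertonDyer.Rank1Residual.Additive.X3DegenerateDisplayKit
import HarnessLib

/-!
# X3, the DEGENERATE rows at `p = 3`, rank `0`: the per-pair DISPLAY KIT for NON-UNIT rows — the
# unit-coefficient certificate at index `n` from ONE Q6 record `CensusQ6.GordOddFirstUnitIndexAt W 3 n`
# (cell `bsd-eis`, seat `bsd-eis-x3` gen 7; sequel of `X3DegenerateDisplayKit.lean`; route K1
# `AdditiveBranchIMC`, crux `GordTwoRankZeroOffCaseOne` — supports only)

HONEST FRAMING (`run/shared/lean/pub/bsd-eis/README.md` §4): the programme's target of record is the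
full Birch–Swinnerton-Dyer formula for every `E/ℚ` of analytic rank `≤ 1`; this file concerns the
DEGENERATE X3♯(G-ord, `e = 2`) rows at `p = 3` only (`W[3]^{ss} = 1 ⊕ ω`: the member with a rational
point of order `3`), on the rows where the predicted `λ`-invariant `n` is POSITIVE (`3 ∣ L(W,1)/Ω_W`;
169 classes on the sub-locus "every `ℓ ∈ Σ₀` has `ℓ ≢ ±1 (mod 9)`" of referee A's residue at state
16a6b5d318458b9f, all with `n = 2`). THEOREMS ONLY; nothing is booked; no label, tier or count of
record moves here.

gen 6's display shape `ClassX3Gord.bsdp_three_degenerate_display` reads the certificate `hcert` at index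
`0` off the unit `L`-value. On a non-unit row the certificate at index `n ≥ 1` is NOT a consequence of
`L(W,1)`: it is the Q6 RECORD `CensusQ6.GordOddFirstUnitIndexAt W 3 n` — "the first `3`-adic unit
coefficient of `ϖ·L₃⁻(f_V, α_V)` (odd branch, twist by `−3`, `Ω⁻`) sits at index `n`" — an INSTRUMENT
datum in the currency of the booked X3♯(M) certificate displays (`hrec`, two engines per
PREDICTIONS-Q6), turned into `X3BranchUnitCoeffCertAt V 3 n` on every twist model by the tree's
`ClassX3Gord.unitCoeffCert_of_gordOddFirstUnitIndex`. Everything else is gen 6's road verbatim: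
`3^{#T} ≤ #H¹(ℚ_Σ/ℚ_∞, Φ₀)` from the order-`3` sub-characters of `χ_ℓ` (`ℓ ∈ T`, `ℓ ≡ 1 (3)`),
`3^k ≤ #U` from `k` certified `Σ₀`-units, and the arithmetic `n + Σδ + 1 ≤ #T + k`.

* `ClassX3Gord.unitCoeffCert_three_of_gordOddFirstUnitIndex` — the record at index `n` gives the
  certificate at index `n` on every twist model (`e = 2` and `p % 4 = 3` discharged at `p = 3`);
* `ClassX3Gord.bsdp_three_degenerate_display_of_record` — the DISPLAY SHAPE for non-unit rows:
  11 PUBLISHED records + ONE Cremona datum `hL : L(W,1) = q·Ω_W`, `q ≠ 0` (for `r_an = 0`) + ONE Q6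
  record `hrec` + kernel data as in gen 6's display, under `n + Σδ + 1 ≤ #T + k`.

References: [GreenbergVatsal2000] §2 pp. 26–30; [GreenbergLNM1716] §3; [MazurTateTeitelbaum1986Invent]
§I.10, §I.13; [SilvermanAEC2009] III.2.3; [Cassels1986] Ch. 4 Lemma 3.1; cell files
`run/shared/lean/pub/bsd-eis/x3-MEMO-8.md`, `OFFER-EIS-X3CERT3*.md` (the `hrec` currency).
-/

set_option autoImplicit false

noncomputable section

open scoped Classical AddSubgroup

namespace Summit.BirchSwinnertonDyer.Rank1Residual.Additive

open WeierstrassCurve NumberField IsDedekindDomain Field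
  Literature.NumberTheory.EllipticCurves
  Literature.NumberTheory.EllipticCurves.ModularForms
  Literature.NumberTheory.EllipticCurves.GreenbergSelmer
  Literature.NumberTheory.EllipticCurves.GreenbergVatsal2000
  Literature.NumberTheory.EllipticCurves.Rank1Residual
  Literature.NumberTheory.EllipticCurves.Rank1Residual.Typed
  Literature.NumberTheory.GaloisRepresentations
  Summit.BirchSwinnertonDyer.Rank1Residual.X1.MuLambda
  Summit.BirchSwinnertonDyer.Rank1Residual.AdditivePotMult
  Summit.BirchSwinnertonDyer.Rank1Residual.Additive.X3Branch

namespace X3DegenerateDisplayKit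

/-! ### §1 The certificate at index `n` from the Q6 record -/

/-- **The unit-coefficient certificate at index `n` from the Q6 record, X3♯(G-ord) at `p = 3`.**
`CensusQ6.GordOddFirstUnitIndexAt W 3 n` (first `3`-adic unit coefficient of `ϖ·L₃⁻` at index `n`)
gives `X3BranchUnitCoeffCertAt V 3 n` on every twist model `V` (`e = 2` at `3` by
`semistabilityIndex_eq_two_of_typeG_three`, `3 % 4 = 3`). [cite: MazurTateTeitelbaum1986Invent, §I.13] -/
theorem _root_.Summit.BirchSwinnertonDyer.Rank1Residual.Additive.ClassX3Gord.unitCoeffCert_three_of_gordOddFirstUnitIndex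
    [Fact (Nat.Prime 3)] {W : WeierstrassCurve ℚ} [W.IsElliptic] [W.IsGloballyMinimal]
    (hX : ClassX3Gord W 3) {n : ℕ} (hrec : CensusQ6.GordOddFirstUnitIndexAt W 3 n)
    (V : WeierstrassCurve ℚ) [V.IsElliptic] [V.IsGloballyMinimal] (C : VariableChange ℚ)
    (hC : C • V.quadraticTwist ((-1) ^ ((3 : ℕ) / 2) * (3 : ℕ) : ℚ) = W) :
    X3BranchUnitCoeffCertAt V 3 n :=
  ClassX3Gord.unitCoeffCert_of_gordOddFirstUnitIndex hX
    (semistabilityIndex_eq_two_of_typeG_three W hX.typeGOrd.typeG hX.addv) (by decide) hrec V C hC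

/-! ### §2 The display end state on NON-UNIT rows -/

/-- **`BSD₃(W)` on a DEGENERATE X3♯(G-ord) row of rank `0` — DISPLAY SHAPE, NON-UNIT rows.**
Displayed: the 11 PUBLISHED records of
`ClassX3Gord.bsdp_three_rankZero_degenerate_of_facts_of_torsionFact_of_classes` (verbatim), ONE
Cremona datum `hL : L(W,1) = q·Ω_W` with `q ≠ 0` (only for `r_an = 0`), and ONE Q6 record
`hrec : CensusQ6.GordOddFirstUnitIndexAt W 3 n` (the first `3`-adic unit coefficient of `ϖ·L₃⁻` at
index `n` — an INSTRUMENT datum). KERNEL data per pair, as in the unit-row display: `ClassX3Gord W 3`;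
`Σ₀ ∌ 3` non-empty with good reduction off `Σ₀ ∪ {3}`; a rational point `(x₀, y₀)` with
`Ψ₃(x₀) = 0 ≠ Ψ₂Sq(x₀)` (the trivial line `Φ₀`); primes `T`, `ℓ ≡ 1 (mod 3)`, under `Σ₀`
(`3^{#T} ≤ #H¹`); `k` natural numbers `a_i` with `ℓ_i ∥ a_i`, `ℓ_i ∤ a_j`, primes under `Σ₀`, `3 ∤ c_i`,
`27 ∣ c_i³ − a_i` (`3^k ≤ #U`); and `n + Σδ + 1 ≤ #T + k`.
[cite: GreenbergVatsal2000, §2 pp. 26–30] [cite: GreenbergLNM1716, §3 p. 86]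
[cite: MazurTateTeitelbaum1986Invent, §I.10 (10.1), §I.13] [cite: SilvermanAEC2009, III.2.3] -/
theorem _root_.Summit.BirchSwinnertonDyer.Rank1Residual.Additive.ClassX3Gord.bsdp_three_degenerate_display_of_record
    [Fact (Nat.Prime 3)] {W : WeierstrassCurve ℚ} [W.IsElliptic] [W.IsGloballyMinimal]
    (hTors : Greenberg1999.finite_torsion_cyclotomicZpExtension)
    (hDelG : Delbourgo1998.prop4_rankZero_constantCoeff_eq_unit_mul_of_potGoodOrd)
    (hDel98 : Delbourgo1998.prop4_rankZero_pow_dvd_constantCoeff)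
    (hGZK : rank_eq_analyticRank_of_analyticRank_le_one) (hmod : hasEntireLFunction_rat)
    (hmodD : nonempty_modularParametrizationData)
    (hW16 : Wuthrich2014.thm16_halfEigenCharIdeal_dvd_cyclotomicPrime)
    (h23 : datumSelmer_nonPrimitive_invariants)
    (hRQ : datumSelmer_divisible_of_finite_torsionBy_of_gr_inertiaInvariants_eq_zero)
    (hGrK : Greenberg1999.imKummer_ge_strictCondition_goodOrdinary)
    (hLiftE : residualEpsilon_surjOn_of_lineEven)
    (hX : ClassX3Gord W 3) {q : ℚ} (hL : W.entireLFunction 1 = (q : ℂ) * (W.realPeriodRat : ℂ))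
    (hq0 : q ≠ 0) {n : ℕ} (hrec : CensusQ6.GordOddFirstUnitIndexAt W 3 n)
    (S₀ : Finset (HeightOneSpectrum (𝓞 ℚ))) (hne : S₀.Nonempty)
    (hS₀ : ∀ v ∈ S₀, ((3 : ℕ) : 𝓞 ℚ) ∉ v.asIdeal)
    (hS : ∀ v : HeightOneSpectrum (𝓞 ℚ), v ∉ S₀ → ((3 : ℕ) : 𝓞 ℚ) ∉ v.asIdeal →
      W.HasGoodReductionAt v)
    {x₀ y₀ : ℚ} (heq : y₀ ^ 2 + W.a₁ * x₀ * y₀ + W.a₃ * y₀ = x₀ ^ 3 + W.a₂ * x₀ ^ 2 + W.a₄ * x₀ + W.a₆)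
    (hψ : W.Ψ₃.eval x₀ = 0) (hd : W.Ψ₂Sq.eval x₀ ≠ 0)
    (T : Finset ℕ) (hT : ∀ ℓ ∈ T, ℓ.Prime ∧ 3 ∣ ℓ - 1 ∧ ∃ v ∈ S₀, ((ℓ : ℕ) : 𝓞 ℚ) ∈ v.asIdeal)
    {k : ℕ} (a ℓ : Fin k → ℕ) (c : Fin k → ℤ) (ha : ∀ i, a i ≠ 0) (hℓ : ∀ i, (ℓ i).Prime)
    (hval : ∀ i j, padicValNat (ℓ i) (a j) = if i = j then 1 else 0)
    (haS : ∀ i (v : HeightOneSpectrum (𝓞 ℚ)), ((a i : ℕ) : 𝓞 ℚ) ∈ v.asIdeal → v ∈ S₀)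
    (hc : ∀ i, ¬ (3 : ℤ) ∣ c i) (hcube : ∀ i, (27 : ℤ) ∣ c i ^ 3 - a i)
    (hcount : n + ∑ v ∈ S₀, delta W 3 v + 1 ≤ T.card + k) :
    BSDp W 3 := by
  -- `r_an = 0` from the non-vanishing `L`-value
  have hr : W.analyticRank = 0 := by
    refine (analyticRank_eq_zero_iff_holds (hmod _)).mpr ?_
    rw [hL]
    exact mul_ne_zero (by exact_mod_cast hq0) (by exact_mod_cast (realPeriodRat_pos_holds (W := W)).ne')
  -- the trivial rational line of the `3`-torsion point
  obtain ⟨Φ₀, hΦ, htriv⟩ := exists_trivialLine_of_ratPoint heq hψ hd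
  refine ClassX3Gord.bsdp_three_rankZero_degenerate_of_facts_of_torsionFact_of_classes hTors hDelG hDel98
    hGZK hmod hmodD hW16 h23 hRQ hGrK hLiftE hX hr S₀ hne hS₀ hS Φ₀ hΦ htriv
    (ClassX3Gord.unitCoeffCert_three_of_gordOddFirstUnitIndex hX hrec) T hT a ℓ c ha hℓ
    (fun i j ↦ by convert hval i j) haS hc hcube ?_
  rwa [Fintype.card_fin]

end X3DegenerateDisplayKit

end Summit.BirchSwinnertonDyer.Rank1Residual.Additive

end
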